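import Summits.BirchSwinnertonDyer.Rank1Residual.ManinAdditive.ALSignCongruence
import HarnessLib
import HarnessLib.Audit.Tags

/-!
# THE TATE COHOMOLOGY OF AN ATKIN–LEHNER INVOLUTION ON THE INTEGRAL CUSP FORMS IS (THE SQUARE ROOT OF) THE MOD-2 HEEGNER
# MODULE OF ITS FIXED POINTS — typed rows E-desc-71…77b (desc g12, MEMO-desc §29; cell `bsd-f2-manin`, T-desc-16, typer g15)

HONEST FRAMING.  LENS = descent / visibility (`bsd-f2-manin-desc` g12, MEMO-desc §29, «LANDED» 2026-08-28T19:39:55Z + suppl.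
19:51:02Z / 19:59:53Z; desc g13 GO «land AS IS» 21:46:33Z).  SOURCE = HOME/desc/g12/Sketch-desc-g12.lean sha16 d687c37d279a3d56 (263 l.;
farm rc 0 · 0 · 0 · 0 per desc), VERBATIM: namespace `…ManinAdditive.DescG12` ↦ `…ManinAdditive.ALTateCohomology`, this header replaces
the sketch's, and the Ogg locator is sharpened to the page read first-hand (Ogg 1974 p. 454: Prop. 3 + the class-number count of the fixed
points of `w_{Q}`; `lit read 10.24033/bsmf.1789`).  Tree declarations only: `integralCuspForms0`, `atkinLehnerInvolutionAt`, `heckeT`,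
`lineIndex`, `ALSignCongruence.alCutLattice` / `alEigenLattice` (T-desc-15 leaf), `ModularParametrizationData`, `jacobiSym`,
`WeierstrassCurve.Δ`.  NOTHING IS ASSERTED: the eight rows are `@[conjecture]` obligation nodes; the helpers (`reducedFormCount`,
`alFixedPointCount`, `wZ`, `tateOrder`, `tateH0Order`, `tateH1Order`, `alCutLatticeAtTwo`) are definitions and
`map_le_alCutLattice_inf_ker` is a SORRY-FREE lemma.  desc g13's sequel (MEMO-desc §30: localisation of `Ĥ*(⟨w_Q⟩, ·)` to the fixed
points, THEOREMS A/E/V/F/ORD/D on paper) lands as the sibling `ALTateLocalization.lean` (T-desc-17) importing these helpers.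

Notation (MEMO-desc §28.9/§29).  `S = S₂(Γ₀(N); ℤ)`, `Q = Q_p = p^{v_p(N)}`, `w = w_Q`, `L_Q = S ∩ w⁻¹S` (two-cusp lattice,
`alCutLattice`), `S^{±} = S ∩ ker(w ∓ 1)` (`alEigenLattice`).  `L_Q` is `w`-stable, and as a `ℤ[⟨w⟩]`-lattice
`L_Q ≅ (ℤ⁺)^{t₊} ⊕ (ℤ⁻)^{t₋} ⊕ ℤ[C₂]^{c}`; the Tate cohomology groups are `Ĥ⁰(⟨w⟩, L_Q) = S⁺/(1+w)L_Q ≅ 𝔽₂^{t₊}` and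
`H¹(⟨w⟩, L_Q) = S⁻/(w−1)L_Q ≅ 𝔽₂^{t₋}`; their orders are `tateH0Order`, `tateH1Order` below.  `ν_Q(N)` = number of
fixed points of `w_Q` on `X₀(N)(ℂ)` = `alFixedPointCount N Q` (class-number formula, `N` odd, `Q ≥ 5`).

ROWS (desc's text; E-blind censuses by desc, engines HOME/desc/g11/eig_ms_z.py 4a3b0d9757619657 → g12/eig_ms_h2.py 1d1ddb3f26e20d07,
g12/eig_l2.py; tallies g12/H2TALLY-g12.txt, HL2TALLY-g12.txt, L2TALLY-g12.txt; rows g12/H2ROWS-g12.txt, HL2ROWS-g12.txt; SHA16SUMS.desc.g12):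
* S-desc-g12 / E-desc-71 `ALTateCohomologyFixedPointLaw` — THEOREM ON PAPER (MEMO §29.2): for odd `N`,
  `(t₊, t₋) = ([ν = 0], max(ν/2 − 1, 0))`.  E-blind census 34/34 odd cells; ν(class numbers) = ν(Riemann–Hurwitz) 34/34.
* E-desc-72 `ALTateH0EisensteinLaw` — THEOREM ON PAPER modulo one identification (MEMO §29.3): for odd `N` the Hecke operators
  `T_ℓ` (`ℓ ∤ N`) act on `Ĥ⁰(⟨w_Q⟩, L_Q)` through the Eisenstein character `ℓ ↦ 1 + ℓ` (incl. `T₂ ↦ 1`).  Census 17/17 free odd cells.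
* E-desc-73 `ALTateH1InertNilpotentLaw` — LAW (the typed shadow of LAW H⁺ of MEMO §29.4: `[H¹ ⊗ 𝔽̄₂]^{ss} ⊕ 𝟙 ≅ ½·𝔽̄₂[Fix(w_Q)]^{ss}`
  as a Hecke module; census 138/138 (cell, ℓ) pairs in 17/17 ramified odd cells): a prime `ℓ` inert in `ℚ(√−Q)` acts nilpotently
  on `H¹(⟨w_Q⟩, L_Q) ⊗ 𝔽₂` (78/78).
* E-desc-74 `ALSlackOneDihedralLaw` — E-facing LAW (MEMO §29.5): at odd `N`, a `w_Q`-minus optimal newform whose two-cusp slack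
  `s(f,Q)` equals 1 is Eisenstein or dihedral-from-`ℚ(√−Q)` mod 2.  Census 6/6 + companions C1 23/23, C2 39/39, C3 1/1.
* E-desc-75 `ALTateOneSidedLaw` — THEOREM A in its intrinsic form (MEMO §29.10): at odd `N`, `Ĥ⁰ = 0 ∨ H¹ = 0`.  34/34 odd cells.
* E-desc-76 `ALTateOneSidedLawAtTwo` — THEOREM A′ (LAW, MEMO §29.10): for `2 ∣ N`, `16 ∤ N`, odd `p ∣ N`, one-sidedness for
  `w_{Q_p}` on the two-cusp lattice AT 2, `L_{Q_p} ∩ L_{Q₂}` (`alCutLatticeAtTwo`) — 36/36 cells; fails at `16 ∣ N` (Q-desc-g12-1′).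
* E-desc-77a/77b `ALTateH0EisensteinLawAtTwo` / `ALTateH1InertNilpotentLawAtTwo` — E-72 / E-73 at even level on `L′`
  (MEMO §29.10 (h)): 38/38 (26 non-vacuous), 101/101, 41/41 fixed-point counts.

NOT IN PRINT (desc, MEMO-desc §29.7/§28.11 placements): the class-number count of `Fix(w_Q)` is Ogg 1974 / Kluit / Furumoto–Hasegawa
and the Heegner-module language is Gross 1987; the TATE-COHOMOLOGY statements (that `Ĥ*(⟨w_Q⟩, S₂(Γ₀(N);ℤ))` is governed by the
mod-2 Heegner module of the fixed points) are the cell's — each row carries its nearest print BY NAME as a shape-only cite.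
REFUTER VERDICTS: REF1 §R88-lite (2026-08-28T20:14:16Z): E-desc-76/77a/77b A1 PASS, BC7 4/4 CLEAN, stability question Q-ref1-88
ANSWERED YES by desc g13 (L′ ⊗ ℤ_r is `w_{Q_p}`-stable for every r, WQSTAB 62/62); §R88 FULL (R-desc-17 (a)–(e): E-desc-71…75 A2–A5)
PENDING at filing — a finding is repaired under a NEW name (append-only, `theorems.append-only`); REF2 placement pending.
bears_on: stmt-BirchSwinnertonDyer-22967 / -22968 (the `2`-part of `c_E` via the two-cusp lattice at `2`, desc lens; no route binder
consumes these rows yet).  PARTITION 0 / ladder-live · beyond-print theorem: desc says E-desc-71/72/75 are print-derivable lemmas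
(new as statements, routine as proofs), E-desc-73/74/76/77 laws · BSD is not proved by this; Manin's conjecture is not proved by this.
-/

noncomputable section

open scoped MatrixGroups ModularForm

open CongruenceSubgroup WeierstrassCurve Literature.NumberTheory.EllipticCurves.ModularForms
  Literature.NumberTheory.DiophantineGeometry

namespace Summit.BirchSwinnertonDyer.Rank1Residual.ManinAdditive.ALTateCohomology

open ALSignCongruence

/-! ### Elementary arithmetic: class numbers of imaginary quadratic orders by reduced forms; the fixed-point count of `w_Q` -/

/-- `h(D)` for a negative discriminant `D` (`D < 0`, `D ≡ 0, 1 mod 4`): the number of primitive reduced positive definite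
binary quadratic forms `(a, b, c)`, `b² − 4ac = D`, `|b| ≤ a ≤ c`, `b ≥ 0` whenever `|b| = a` or `a = c`, `gcd(a,b,c) = 1`
— the class number of the quadratic ORDER of discriminant `D` (maximal or not).  `0` for any other `D`.  Decidable/computable. -/
def reducedFormCount (D : ℤ) : ℕ :=
  if D < 0 ∧ (D % 4 = 0 ∨ D % 4 = 1) then
    (((Finset.Icc (1 : ℤ) (-D)) ×ˢ (Finset.Icc D (-D))).filter (fun ab =>
      (ab.2 * ab.2 - D) % (4 * ab.1) = 0 ∧ -ab.1 < ab.2 ∧ ab.2 ≤ ab.1 ∧ ab.1 ≤ (ab.2 * ab.2 - D) / (4 * ab.1) ∧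
      (0 ≤ ab.2 ∨ ab.1 ≠ (ab.2 * ab.2 - D) / (4 * ab.1)) ∧
      Int.gcd (Int.gcd ab.1 ab.2) ((ab.2 * ab.2 - D) / (4 * ab.1)) = 1)).card
  else 0

/-- **`ν_Q(N)`, the number of fixed points of `w_Q` on `X₀(N)(ℂ)`** for `N` odd, `Q ∥ N`, `Q ≥ 5` (Ogg / Kluit / Furumoto–Hasegawa
class-number formula): `ν_Q(N) = Σ_{D ∈ {−4Q} ∪ {−Q : Q ≡ 3 (4)}} h(D) · ∏_{ℓ ∣ N/Q prime} (1 + (D/ℓ))` (for odd `ℓ ∤ D` the local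
factor `1 + (D/ℓ)` counts the `w_Q`-compatible level structures at `ℓ^e ∥ N/Q`, any `e ≥ 1`).  At odd `N` it agrees with the
Riemann–Hurwitz value `2·dim S₂(N) + 2 − 4·dim S₂(N)^{w_Q = +1}` in 34/34 census cells (MEMO §29.2).  No claim at even `N` or `Q ≤ 4`. -/
def alFixedPointCount (N Q : ℕ) : ℤ :=
  (reducedFormCount (-4 * (Q : ℤ)) : ℤ) * (∏ ℓ ∈ (N / Q).primeFactors, (1 + jacobiSym (-4 * (Q : ℤ)) ℓ)) +
    (if Q % 4 = 3 then (reducedFormCount (-(Q : ℤ)) : ℤ) * (∏ ℓ ∈ (N / Q).primeFactors, (1 + jacobiSym (-(Q : ℤ)) ℓ)) else 0)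

/-! ### The Tate cohomology of `⟨w_Q⟩` on the two-cusp lattice (orders; tree declarations only) -/

section Tate

variable {N : ℕ} [NeZero N]

variable (N) in
/-- `w_{Q_p}` as a `ℤ`-linear map. -/
abbrev wZ (p : ℕ) : CuspForm (Gamma0 N) 2 →ₗ[ℤ] CuspForm (Gamma0 N) 2 :=
  (atkinLehnerInvolutionAt N 2 p).restrictScalars ℤ

/-- Order of the Tate cohomology group of sign `ε` of the involution `w` on a `w`-stable lattice `L`:
`tateOrder L w 1 = [L ∩ ker(w − 1) : (w + 1)L] = #Ĥ⁰(⟨w⟩, L)` and `tateOrder L w (−1) = [L ∩ ker(w + 1) : (w − 1)L] = #H¹(⟨w⟩, L)`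
(`AddSubgroup.relIndex`; for a finitely generated `L` these are powers of 2, `2^{t₊}` and `2^{t₋}`). -/
def tateOrder (L : Submodule ℤ (CuspForm (Gamma0 N) 2)) (w : CuspForm (Gamma0 N) 2 →ₗ[ℤ] CuspForm (Gamma0 N) 2)
    (ε : ℤ) : ℕ :=
  (L.map (w + ε • LinearMap.id)).toAddSubgroup.relIndex (L ⊓ LinearMap.ker (w - ε • LinearMap.id)).toAddSubgroup

variable (N) in
/-- `#Ĥ⁰(⟨w_{Q_p}⟩, L_{Q_p}) = [S⁺ : (1 + w)L_{Q_p}]` (`= 2^{t₊}`; `L_{Q_p} ∩ ker(w − 1) = S⁺ = alEigenLattice N p 1` by the g11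
sandwich `alEigenLattice_le_alCutLattice`). -/
def tateH0Order (p : ℕ) : ℕ := tateOrder (alCutLattice N p) (wZ N p) 1

variable (N) in
/-- `#H¹(⟨w_{Q_p}⟩, L_{Q_p}) = [S⁻ : (w − 1)L_{Q_p}]` (`= 2^{t₋}`). -/
def tateH1Order (p : ℕ) : ℕ := tateOrder (alCutLattice N p) (wZ N p) (-1)

variable (N) in
/-- The two-cusp lattice AT 2 AND `p`: `L_{Q_p} ∩ L_{Q₂} = S ∩ w_{Q_p}⁻¹S ∩ w_{Q₂}⁻¹S` — for `2 ∥ N` conjecturally (MEMO §29.10)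
`(S ∩ w₂S) ⊗ ℤ₂ = H⁰(X₀(N)_{ℤ₂}, ω)` (relative dualising sheaf of the Deligne–Rapoport model: q-expansion principle on BOTH
components), the lattice on which THEOREM A survives at even level. -/
def alCutLatticeAtTwo (p : ℕ) : Submodule ℤ (CuspForm (Gamma0 N) 2) := alCutLattice N p ⊓ alCutLattice N 2

/-- `(w + ε)L ⊆ L ∩ ker(w − ε)` for the two-cusp lattice `L = L_{Q_p}` when `w` is an involution and `ε² = 1` (PROVED; the
hypothesis is Atkin–Lehner's `w_Q² = 1`, kept explicit as in the g11 sandwich). -/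
theorem map_le_alCutLattice_inf_ker (p : ℕ) (ε : ℤ) (hε : ε * ε = 1)
    (hw : ∀ x, atkinLehnerInvolutionAt N 2 p (atkinLehnerInvolutionAt N 2 p x) = x) :
    (alCutLattice N p).map (wZ N p + ε • LinearMap.id) ≤
      alCutLattice N p ⊓ LinearMap.ker (wZ N p - ε • LinearMap.id) := by
  rintro _ ⟨x, hx, rfl⟩
  have hx' : x ∈ alCutLattice N p := hx
  rw [alCutLattice, Submodule.mem_inf, Submodule.mem_comap, LinearMap.restrictScalars_apply] at hx'
  obtain ⟨hxS, hwxS⟩ := hx'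
  have e1 : (wZ N p + ε • LinearMap.id : CuspForm (Gamma0 N) 2 →ₗ[ℤ] CuspForm (Gamma0 N) 2) x =
      atkinLehnerInvolutionAt N 2 p x + ε • x := by
    simp only [LinearMap.add_apply, LinearMap.smul_apply, LinearMap.id_apply, LinearMap.restrictScalars_apply]
  have e2 : atkinLehnerInvolutionAt N 2 p (atkinLehnerInvolutionAt N 2 p x + ε • x) =
      x + ε • atkinLehnerInvolutionAt N 2 p x := by
    rw [map_add, map_zsmul, hw]
  rw [e1, Submodule.mem_inf, alCutLattice, Submodule.mem_inf, Submodule.mem_comap, LinearMap.restrictScalars_apply,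
    LinearMap.mem_ker, e2]
  refine ⟨⟨add_mem hwxS (Submodule.smul_mem _ ε hxS), add_mem hxS (Submodule.smul_mem _ ε hwxS)⟩, ?_⟩
  rw [LinearMap.sub_apply, LinearMap.smul_apply, LinearMap.id_apply, LinearMap.restrictScalars_apply, e2, smul_add,
    smul_smul, hε, one_smul]
  abel

end Tate

/-! ### Candidates (nothing asserted) -/

/-- **S-desc-g12 / E-desc-71 `ALTateCohomologyFixedPointLaw` — THEOREM ON PAPER (MEMO-desc §29.2).**  For odd `N`, a prime
`p ∣ N` with `Q = p^{v_p(N)} ≥ 5`: `#Ĥ⁰(⟨w_Q⟩, L_Q) = 2^{[ν_Q(N) = 0]}` and `#H¹(⟨w_Q⟩, L_Q) = 2^{max(ν_Q(N)/2 − 1, 0)}`; i.e. the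
two-cusp lattice has exactly `g⁺ − [ν = 0]` free `ℤ₂[w_Q]`-summands (`g⁺ = dim S₂(N)^{+}`).  Proof inputs (all standard):
`S ⊗ ℤ₂ = H⁰(X₀(N)_{ℤ₂}, Ω)` (q-expansion principle, `2 ∤ N`; `[S : L_Q]` is supported on primes dividing `N`), cohomology and
base change, Krull–Schmidt for `ℤ₂[C₂]`-lattices (`ℤ⁺, ℤ⁻, ℤ₂[C₂]`), "number of indecomposable `k[C₂]`-summands of
`H⁰(X_k, Ω)` = `dim H⁰(X_k, Ω)^{C₂}` = `h⁰(Y, Ω_Y(D))`" with `Y = X_k/C₂`, `deg D = ½ Σ_x d_x`, Riemann–Hurwitz on both fibres and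
`g(Y) = g⁺` (ℓ-adic `H¹` + smooth base change) — whence `Σ_x d_x = ν_Q(N)`.  E-blind census (MS-0/eig + ZTEST, 148 levels):
34/34 odd cells; at even `N` the free-summand DEFECT `δ(N, Q) := (g⁺ − [ν=0]) − c ≥ 0` is `0` in 16/20 cells with `2 ∥ N`,
5/21 with `4 ∣ N` (`Q` odd), 56/97 with `Q = 2^v` (table H2ROWS-g12; the bad fibre at 2 — MEMO §29.6, open Q-desc-g12-1).
[cite: Ogg1974, Prop. 3 and p. 454 (shape only: fixed points of Atkin–Lehner involutions via class numbers; the Tate-cohomology statement is the cell's S-desc-g12 — desc MEMO-desc §29)] -/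
@[conjecture]
def ALTateCohomologyFixedPointLaw : Prop :=
  ∀ (N : ℕ) [NeZero N] (p : ℕ), p.Prime → p ∣ N → ¬ 2 ∣ N → 5 ≤ p ^ N.factorization p →
    (tateH0Order N p = if alFixedPointCount N (p ^ N.factorization p) = 0 then 2 else 1) ∧
      tateH1Order N p = 2 ^ Int.toNat (alFixedPointCount N (p ^ N.factorization p) / 2 - 1)

/-- **E-desc-75 `ALTateOneSidedLaw` — THEOREM A, intrinsic form (MEMO-desc §29.10; THEOREM ON PAPER at odd `N`).**  For odd `N`
and a prime `p ∣ N`: `Ĥ⁰(⟨w_{Q_p}⟩, L_{Q_p}) = 0` or `H¹(⟨w_{Q_p}⟩, L_{Q_p}) = 0` — the two-cusp lattice `L_{Q_p} ⊗ ℤ₂ ≅ (ℤ⁺)^{t₊} ⊕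
(ℤ⁻)^{t₋} ⊕ ℤ₂[C₂]^c` has `t₊ · t₋ = 0`, i.e. `c = min(g⁺, g⁻)` free summands (then `t₊ = [g⁺ = g⁻ + 1]`, `t₋ = max(g⁻ − g⁺, 0)` by
`t₊ + c = g⁺`, `t₋ + c = g⁻`; this is E-desc-71 with `ν = 2g + 2 − 4g⁺` eliminated).  No `Q ≥ 5` needed.  Census 34/34 odd cells.
[cite: Ogg1974, Prop. 3 and p. 454 (shape only: `g⁺` via fixed points of `w_Q`; the one-sidedness statement is the cell's E-desc-75 — desc MEMO-desc §29)] -/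
@[conjecture]
def ALTateOneSidedLaw : Prop :=
  ∀ (N : ℕ) [NeZero N] (p : ℕ), p.Prime → p ∣ N → ¬ 2 ∣ N → tateH0Order N p = 1 ∨ tateH1Order N p = 1

/-- **E-desc-76 `ALTateOneSidedLawAtTwo` — THEOREM A′ (LAW; MEMO-desc §29.10).**  For `2 ∣ N`, `16 ∤ N` and an odd prime `p ∣ N`:
`w_{Q_p}` acting on the two-cusp lattice at 2 and `p`, `L′ = L_{Q_p} ∩ L_{Q₂} = S ∩ w_{Q_p}⁻¹S ∩ w_{Q₂}⁻¹S` (`alCutLatticeAtTwo`), has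
`Ĥ⁰(⟨w_{Q_p}⟩, L′) = 0` or `H¹(⟨w_{Q_p}⟩, L′) = 0`.  Mechanism (`2 ∥ N`): `L′ ⊗ ℤ₂ = H⁰(X₀(N)_{ℤ₂}, ω)` for the Deligne–Rapoport
model (q-expansion principle on both components `C_∞ ∪ C_0` of the special fibre; `S ⊗ ℤ₂` is strictly bigger, by the `2`-old forms
`½·π₂^*` and the level-raising congruences at 2), and the proof of THEOREM A runs on `H⁰(X, ω)` with the nodal fibre.  E-blind census
(`eig_l2.py`): 36/36 cells with `v₂(N) ∈ {1,2,3}` (on `L_{Q_p}` itself the law fails in 20/41 of them — the defect `δ(N, Q)` of §29.6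
equals `c(L′) − c(L_{Q_p})` in 36/36); at `16 ∣ N` it FAILS ((144, Q₉), (288, Q₉), (576, Q₉): residual defects 1, 1, 2 — the lattice
`H⁰(X, ω)` of a good model at `2^v`, `v ≥ 4`, is smaller still: Q-desc-g12-1′).  Why it might fail below 16: a level `8 ∥ N` outside the
six tested (72, 200, 216, 360, 392, 648) where the Katz–Mazur fibre at 2 breaks a further summand.
[cite: DeligneRapoport1973, VI.6.9 (shape only: the two-component special fibre of `X₀(2M)` at 2; the lattice statement is the cell's E-desc-76 — desc MEMO-desc §29)] -/
@[conjecture]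
def ALTateOneSidedLawAtTwo : Prop :=
  ∀ (N : ℕ) [NeZero N] (p : ℕ), p.Prime → p ≠ 2 → p ∣ N → 2 ∣ N → ¬ 16 ∣ N →
    tateOrder (alCutLatticeAtTwo N p) (wZ N p) 1 = 1 ∨ tateOrder (alCutLatticeAtTwo N p) (wZ N p) (-1) = 1

/-- **E-desc-72 `ALTateH0EisensteinLaw` — THEOREM ON PAPER modulo one identification (MEMO-desc §29.3).**  For odd `N`, `p ∣ N`
and every prime `ℓ ∤ N`: `T_ℓ ≡ 1 + ℓ` on `Ĥ⁰(⟨w_{Q_p}⟩, L_{Q_p}) = S⁺/(1 + w)L_{Q_p}` (so `T₂ ≡ 1`, `T_ℓ ≡ 0` for odd `ℓ`).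
Mechanism: `Ĥ⁰ ≠ 0` only in the étale case `ν = 0`, where `Ĥ⁰(⟨w⟩, H⁰(X, Ω)) ≅ H¹(X₀(N)⁺_{𝔽₂}, Ω) ≅ 𝔽₂` and a correspondence acts
on `H¹(Y, Ω_Y)` by its degree `1 + ℓ`.  In the ramified case the statement only says `T_ℓ S⁺ ⊆ S⁺` (true: `T_ℓ` is integral at `∞`
and commutes with `w_Q`).  Census: 17/17 free odd cells have `Ĥ⁰` = ONE line with `T_ℓ = 1 + ℓ` for all `ℓ ≤ 40` incl. `ℓ = 2`
(corrects MEMO §28.10(c)).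
[cite: AtkinLehner1970, Lemma 11 (shape only: `T_ℓ` commutes with `w_Q` for `ℓ ∤ N`; the Eisenstein statement is the cell's E-desc-72 — desc MEMO-desc §29)] -/
@[conjecture]
def ALTateH0EisensteinLaw : Prop :=
  ∀ (N : ℕ) [NeZero N] (p ℓ : ℕ) [NeZero ℓ], p.Prime → p ∣ N → ¬ 2 ∣ N → ℓ.Prime → ¬ ℓ ∣ N →
    ∀ x ∈ alEigenLattice N p 1,
      (heckeT (Gamma0 N) 2 ℓ).restrictScalars ℤ x - ((1 + ℓ : ℕ) : ℤ) • x ∈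
        (alCutLattice N p).map (wZ N p + LinearMap.id)

/-- **E-desc-73 `ALTateH1InertNilpotentLaw` — LAW (typed shadow of LAW H⁺, MEMO-desc §29.4).**  For odd `N`, `p ∣ N` with
`Q = p^{v_p(N)} ≥ 5`, and an odd prime `ℓ ∤ N` INERT in `ℚ(√−Q)` (`(−Q/ℓ) = −1`): `T_ℓ` is nilpotent on
`H¹(⟨w_Q⟩, L_Q) ⊗ 𝔽₂ = S⁻/(w − 1)L_Q`.  (LAW H⁺ itself: for every odd `ℓ ∤ N`, `charpoly(T_ℓ | H¹ ⊗ 𝔽₂) = √P_ℓ(x) / x` where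
`P_ℓ` is the characteristic polynomial of `T_ℓ` on the mod-2 Heegner module `𝔽₂[Fix(w_Q)]` — `x_𝔞 ↦ x_{𝔞𝔩} + x_{𝔞𝔩̄}` at split
`ℓ`, `0` at inert `ℓ` — so `P_ℓ = ∏_D (Ψ_{n_D(ℓ)}^{h(D)/n_D(ℓ)} or x^{h(D)})^{#or(D)}`, `n_D(ℓ)` = order of `[𝔩]` in `Pic(O_D)`,
`Ψ_n(x) = ∏_{ζ^n = 1}(x − ζ − ζ⁻¹) mod 2`; `P_ℓ` is always a square.  Census 138/138 (cell, ℓ ≤ 40) pairs, 17/17 ramified odd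
cells, inert 78/78; e.g. (243, Q₂₄₃): `t₋ = 5`, `Pic(O_{−972}) ≅ (ℤ/3)²`; (361, Q₃₆₁): `t₋ = 4`, classes of order 5 and 10,
eigenvalues in `𝔽₄`.)  Why it might fail: a level where two Heegner fixed points of different orientation collide mod 2 with
extra wild jump.
[cite: Gross1987, §3 (shape only: Hecke action on Heegner points / the Heegner module; the Tate-cohomology law is the cell's E-desc-73 — desc MEMO-desc §29)] -/
@[conjecture]
def ALTateH1InertNilpotentLaw : Prop :=
  ∀ (N : ℕ) [NeZero N] (p ℓ : ℕ) [NeZero ℓ], p.Prime → p ∣ N → ¬ 2 ∣ N → 5 ≤ p ^ N.factorization p →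
    ℓ.Prime → ¬ ℓ ∣ N → ℓ ≠ 2 → jacobiSym (-((p ^ N.factorization p : ℕ) : ℤ)) ℓ = -1 →
    ∃ n : ℕ, ∀ x ∈ alEigenLattice N p (-1),
      (((heckeT (Gamma0 N) 2 ℓ).restrictScalars ℤ) ^ n) x ∈ (alCutLattice N p).map (wZ N p - LinearMap.id)

/-- **E-desc-77a `ALTateH0EisensteinLawAtTwo` — LAW (MEMO-desc §29.10 (h)).**  E-desc-72 at even level on the two-cusp lattice at 2
and `p`: for `2 ∣ N`, `16 ∤ N`, an odd prime `p ∣ N`, `L′ = alCutLatticeAtTwo N p`, and every odd prime `ℓ ∤ N`, `T_ℓ ≡ 1 + ℓ` on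
`Ĥ⁰(⟨w_{Q_p}⟩, L′) = (L′ ∩ ker(w − 1)) / (w + 1)L′`.  E-blind census (HL2 rows): 38/38 cells with `v₂(N) ≤ 3` or `N ∈ {400, 432}`
(26 free cells: one Eisenstein line each; 12 ramified cells: `Ĥ⁰(L′) = 0`, vacuous); at (144, Q₉), (288, Q₉), (576, Q₉) `Ĥ⁰(L′)` has 2, 2, 3 lines,
all Eisenstein.  Why it might fail: an `8 ∥ N` level outside the six tested.
[cite: Mazur1977, Prop. II.9.7 (shape only: Eisenstein ideal acting on a rank-one quotient; the statement is the cell's E-desc-77a — desc MEMO-desc §29)] -/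
@[conjecture]
def ALTateH0EisensteinLawAtTwo : Prop :=
  ∀ (N : ℕ) [NeZero N] (p ℓ : ℕ) [NeZero ℓ], p.Prime → p ≠ 2 → p ∣ N → 2 ∣ N → ¬ 16 ∣ N → ℓ.Prime → ¬ ℓ ∣ N → ℓ ≠ 2 →
    ∀ x ∈ alCutLatticeAtTwo N p ⊓ LinearMap.ker (wZ N p - LinearMap.id),
      (heckeT (Gamma0 N) 2 ℓ).restrictScalars ℤ x - ((1 + ℓ : ℕ) : ℤ) • x ∈
        (alCutLatticeAtTwo N p).map (wZ N p + LinearMap.id)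

/-- **E-desc-77b `ALTateH1InertNilpotentLawAtTwo` — LAW (typed shadow of LAW H⁺ at even level, MEMO-desc §29.10 (h)).**  For
`2 ∣ N`, `16 ∤ N`, an odd prime `p ∣ N` with `Q = p^{v_p(N)}`, `L′ = alCutLatticeAtTwo N p`, and an odd prime `ℓ ∤ N` INERT in
`ℚ(√−Q)`: `T_ℓ` is nilpotent on `H¹(⟨w_Q⟩, L′) ⊗ 𝔽₂ = (L′ ∩ ker(w + 1)) / (w − 1)L′`.  Behind it (LAW H⁺ at even level, E-blind
101/101 (cell, ℓ) pairs, 11/11 ramified cells, inert 55/55): `charpoly(T_ℓ | H¹(L′) ⊗ 𝔽₂) = √(P_ℓ) / x` with `P_ℓ` the characteristic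
polynomial of `[𝔩]` on `m · 𝔽₂[Pic(O_{−4Q})]^{or}`, `or = ∏_{odd ℓ′ ∣ N/Q} (1 + (−4Q/ℓ′))`, and the LEVEL-2 FACTOR `m = 1 + [Q ≡ 3 (8)]`
(`2 ∥ N/Q`), `2·[Q ≡ 3 (4)]` (`4 ∥ N/Q`), `0` (`8 ∣ N/Q`) — equivalently `#Fix(w_Q) = m · h(−4Q) · or` (41/41 cells against
Riemann–Hurwitz; the `w_Q`-stable cyclic `2^e`-structures on a CM point: one `√−Q`-stable line on `E[2]` for `End E = ℤ[√−Q]`, all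
three for `End E = O_{ℚ(√−Q)}` when `Q ≡ 3 (4)`, the `±√−Q (mod 4)`-eigenlines on `E[4]`, none on `E[8]` unless `Q ≡ 7 (8)`).
Why it might fail: `Q ≡ 7 (mod 8)` (no cell tested; there `m` and the `2^e`-structures change: `−Q` is a square mod 8).
[cite: GrossZagier1986, §II.1 (shape only: Heegner points as CM points with cyclic level structure = ideals of the order; the mod-2 Hecke statement is the cell's E-desc-77b — desc MEMO-desc §29)] -/
@[conjecture]
def ALTateH1InertNilpotentLawAtTwo : Prop :=
  ∀ (N : ℕ) [NeZero N] (p ℓ : ℕ) [NeZero ℓ], p.Prime → p ≠ 2 → p ∣ N → 2 ∣ N → ¬ 16 ∣ N →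
    ℓ.Prime → ¬ ℓ ∣ N → ℓ ≠ 2 → jacobiSym (-((p ^ N.factorization p : ℕ) : ℤ)) ℓ = -1 →
    ∃ n : ℕ, ∀ x ∈ alCutLatticeAtTwo N p ⊓ LinearMap.ker (wZ N p + LinearMap.id),
      (((heckeT (Gamma0 N) 2 ℓ).restrictScalars ℤ) ^ n) x ∈ (alCutLatticeAtTwo N p).map (wZ N p - LinearMap.id)

/-- **E-desc-74 `ALSlackOneDihedralLaw` — E-facing LAW (MEMO-desc §29.5).**  `E/ℚ` elliptic of ODD conductor `N`, `D` a
modular parametrisation datum of level `N` (newform `f = D.f`), `p ∣ N` with `Q = p^{v_p(N)} ≥ 5`, `w_Q f = −f`, and two-cusp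
slack one: `[e_f L_Q : ℤf] = [e_f S⁻ : ℤf]` (`s(f, Q) = 1`, i.e. by S-desc-g11′ the mod-2 `f`-functional factors through
`H¹(⟨w_Q⟩, L_Q)`).  Then `f` is Eisenstein or dihedral from `ℚ(√−Q)` mod 2: `E(ℚ)` has a point of order 2, or `−Q·Δ_E` is a
square in `ℚ` (`ℚ(√Δ_E) = ℚ(√−Q)`, so `ρ̄_{E,2}(G_ℚ) ≅ S₃` cuts out an `S₃`-field with quadratic resolvent `ℚ(√−Q)`).  Derived from
E-desc-71/73 (LAW H⁺) + S-desc-g11′ (ii); census 6/6 slack-one minus incidences at odd `N` (121a1, 121c1 ↔ `θ_χ`, `χ` of order 3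
on `Pic(ℤ[11i])`, checked prime-by-prime to `ℓ ≤ 1200`, 194/194 each; 27a1, 243b1 ↔ `ℚ(√−3)`; 45a1, 49a1 Eisenstein) and the
companion counts C1 23/23 (`ν > 0 ∧ ε = +1 ⇒ s = 2`), C2 39/39 (`ν = 0 ∧ ε = −1 ⇒ s = 2`), C3 1/1 (75b1).
[cite: AgasheRibetStein2012, Prop. 2.3 (shape only: congruence number vs modular degree; the slack/dihedral statement is the cell's E-desc-74 — desc MEMO-desc §29)] -/
@[conjecture]
def ALSlackOneDihedralLaw : Prop :=
  ∀ (W : WeierstrassCurve ℚ) [W.IsElliptic] [NeZero (W.conductorNorm ℤ)]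
    (D : ModularParametrizationData W (W.conductorNorm ℤ)),
    ¬ 2 ∣ W.conductorNorm ℤ →
    ∀ p : ℕ, p.Prime → p ∣ W.conductorNorm ℤ → 5 ≤ p ^ (W.conductorNorm ℤ).factorization p →
      atkinLehnerInvolutionAt (W.conductorNorm ℤ) 2 p D.f = (-1 : ℂ) • D.f →
      lineIndex (alCutLattice (W.conductorNorm ℤ) p) D.f = lineIndex (alEigenLattice (W.conductorNorm ℤ) p (-1)) D.f →
      (∃ P : W.toAffine.Point, P ≠ 0 ∧ (2 : ℕ) • P = 0) ∨
        IsSquare (-((p : ℚ) ^ (W.conductorNorm ℤ).factorization p) * W.Δ)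

end Summit.BirchSwinnertonDyer.Rank1Residual.ManinAdditive.ALTateCohomology

end
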